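import Literature.AnabelianGeometry.EtaleTheta.Discharge.Sec3Thm37ivGenuineBase
import Literature.AnabelianGeometry.EtaleTheta.Discharge.Sec3BLambdaInjectiveOfRlfR
import Literature.AlgebraicGeometry.Frobenioids.RealificationMonoidOn
import HarnessLib

/-!
# [EtTh] Def 3.6 (i), monoid type `Λ = ℝ`: the binder `hBinj` ("pull-backs of `B₀^ℝ = ℝ·Φ₀^birat` are injective")
# at the CONSTRUCTED data `ofRlfR` — the DIVISIBILITY-REFLECTION route: two Def 3.3 (iii)-level clauses on `Φ₀` (proof-only)

S. Mochizuki, *The étale theta function and its Frobenioid-theoretic manifestations*, Publ. RIMS **45** (2009)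
[MochizukiEtTh2009], Def. 3.3 (iii) PDF p. 73 (`Φ₀(Y) = lim Div⁺(Z^log_∞)^{Gal(Z^log_∞/Y)}`: Galois-invariant
effective log-divisors of CONNECTED tempered coverings, contravariant in `Y`), Def. 3.6 (i) p. 76 ("`Φ₀^ℝ := Φ₀^rlf`";
"`B₀^Λ` for … `ℝ·Φ₀^birat` if `Λ = ℝ`", the `ℝ`-vector subspace of `(Φ₀^ℝ)^gp` generated by `Φ₀^birat`)
[cite: MochizukiEtTh2009, Def 3.6 p.76]; S. Mochizuki, *The geometry of Frobenioids I*, Kyushu J. Math. **62** (2008),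
Def. 1.1 (ii) p. 19 / Thm. 5.2 preamble p. 100 ("`B` a group-like monoid on `D`": pull-back maps injective),
Prop. 5.3 p. 103 ("the divisor monoid `Φ^rlf`", "the rational function monoid `ℝ·Φ^birat`")
[cite: MochizukiFrdI2008, Prop. 5.3 p.103].

abc-iut cell, block C / W6, seat abc-iut-w6-d048 (gen 3; lineage row EtTh:Thm3.7(iv): `Sec3Thm37ivGenuineBase`,
`TemperedFrobenioidRestrict`).  PROOF-ONLY (0 definitions, 0 `Prop` facts, 0 instances).

THE BINDER.  Every structural consumer of a tempered Frobenioid `C` over Def. 3.6 (i) data `T` — `hBmon` "`B` is a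
monoid on `D`" (`TemperedFrobenioid.isMonoidOn_ratFnFunctor`), "`C` IS a Frobenioid" (`isFrobenioid_of_structural`),
the Thm. 4.4 residual `{hBinj₁, hBinj₂, T44-L15b}` — carries
`hBinj : ∀ {Y Y'} (g : Y ⟶ Y'), Injective (T.BΛ.map g).hom`, a property of the datum `B₀^Λ`.  For the data
CONSTRUCTED from Def. 3.3 (iii) data `dm`, abc-iut-L2-t3's `Sec3BLambdaInjectiveOfRlf.lean` reduces it at `Λ ∈ {ℤ, ℚ}`
(`ofRlfZ`, `ofRlfQ`, weak twins) to the `B₀`-level clause `hB₀inj`, and records for `Λ = ℝ` (`ofRlfR`,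
`B₀^ℝ = ℝ·Φ₀^birat ⊆ (Φ₀^rlf)^gp`): "injectivity of realified pull-backs is NOT formal (cell finding P53-F2 …) —
stays the binder `hBinj` there"; abc-iut-w5-d153's sibling `Sec3BLambdaInjectiveOfRlfR.lean` (landed minutes before this
file) then reduces it to `hrlf` "the realified pull-backs `Φ₀(g)^rlf` are injective" (`ofRlfR_hBinj_of_rlfMap_injective`,
consumed here BY NAME) and discharges `hrlf` on the P53-F2 route from THREE `Φ₀`-level clauses (injective pull-backs,
disjointly supported pull-backs of distinct primes, countable supports).

WHAT THIS FILE PROVES.  The OTHER route (P53-F1's positive half, divisibility reflection): at `Λ = ℝ` the binder is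
formal in TWO elementary Def. 3.3 (iii)-level clauses on `Φ₀` — no countability, no support bookkeeping — of the same
epistemic standing as `hB₀inj` ("inclusion of invariants"):
* `hΦinj  : ∀ g, Injective (dm.Φ₀.map g).hom` — pull-back of effective log-divisors along a connected covering
  `Y' → Y` is injective;
* `hΦrefl : ∀ g a b, Φ₀(g) a ∣ Φ₀(g) b → a ∣ b` — and REFLECTS divisibility.
For print's `Φ₀` both are immediate from Def. 3.3 (iii): computed on a common `Δ^fil`-closure `Z_∞`, `Φ₀(Y) =
Div⁺(Z_∞)^{Gal(Z_∞/Y)} ⊆ Div⁺(Z_∞)^{Gal(Z_∞/Y')} = Φ₀(Y')` is an INCLUSION of submonoids of the monoid of effective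
log-divisors on `Z_∞` (where `a ∣ b` means `b − a` effective), and `b − a` is `Gal(Z_∞/Y)`-invariant when `a`, `b` are.
The route is the POSITIVE half of the cell's P53 analysis ([FrdI] sub-DAG W3, rows P53/L02a–c, seats abc-iut-w5-d137
/ abc-iut-L1-d2, `RealificationMonoidOn.lean`): `IsPerfFactorial.Rlf.map_injective_of_reflects` — for an injective,
divisibility-REFLECTING homomorphism `f` of perf-factorial monoids, `f^rlf` is injective (finding P53-F1: false for
merely characteristically injective `f`; the finite-support obstruction P53-F2 concerns that other route and does not
arise here) — and the pull-back of `ℝ·Φ₀^birat ⊆ (Φ₀^rlf)^gp` along `g` is the restriction of `(Φ₀(g)^rlf)^gp`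
(`GpSubfunctor.toMonoid`), injective with `Φ₀(g)^rlf` since `Φ₀(Y)^rlf` is cancellative.
* §1 `RealifiedDivisorMonoids.ofRlfR_rlfMap_injective_of_reflects` / `ofRlfR_ΦR_map_injective_of_reflects` —
  `Φ₀(g)^rlf = Φ₀^ℝ(g)` is injective; `ofRlfR_hBinj_of_reflects` — **`hBinj` at `ofRlfR dm hpf` from `hΦinj`, `hΦrefl`**
  (via the sibling's `ofRlfR_hBinj_of_rlfMap_injective`); `isMonoidOn_ΦR_ofRlfR_of_reflects` — Def. 3.6 (i)
  "`Φ₀^ℝ := Φ₀^rlf`" IS a monoid on `D₀` ([FrdI] Def. 1.1 (ii)) when `Φ₀` is (Prop. 3.4 (i) "`Φ₀` defines a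
  divisorial monoid on `D₀`") and its pull-backs reflect divisibility (row P53/L02a at the [EtTh] data).
* §2 the structural consumers over `ofRlfR`, re-based on the two clauses: over any base of FSM-type
  (`isMonoidOn_ratFnFunctor_ofRlfR_of_isOfFSMType`, `isFrobenioid_ofRlfR_of_isOfFSMType` — Def. 3.6 (ii), last
  sentence: "the data `(D, Φ, B, B → Φ^gp)` determines a model Frobenioid `C`", at `Λ = ℝ`) and over print's GENUINE
  base `D = B^temp(Π)⁰ = ConnectedPart (BTemp Π)` (`isMonoidOn_ratFnFunctor_ofRlfR_connectedPart_bTemp`,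
  `isFrobenioid_ofRlfR_connectedPart_bTemp`: NO Def-3.6-level binder left).
Binder census at `Λ = ℝ`: {`hBinj`} ↦ {`hΦinj`, `hΦrefl`}.  NOT restated here: Thm. 3.7 (iv) itself, which
abc-iut-f-047's `thm37_iv_ofRlfR_holds` (`Sec3Thm37UnitsTreeMonoidVocab.lean`) already proves over `ofRlfR` with no
hypothesis (superseding the `hBinj`-form `isSlim_category_ofRlfR_connectedPart_bTemp` of `Sec3Thm37ivGenuineBase` §3).
HONEST FRAMING: refereed pre-IUT material ([FrdI] 2008, [EtTh] 2009); a reduction between explicit hypotheses on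
abstract data, nothing asserted for an actual curve; nothing here bears on [IUTchIII] Cor. 3.12; typed ≠ proved.
-/

namespace Literature.AnabelianGeometry.EtaleTheta

open CategoryTheory Opposite Function Literature.AlgebraicGeometry.Frobenioids
  Literature.AnabelianGeometry.SemiGraphs

universe u₀ v₀ u v w

/-! ### §1 `hBinj` at `ofRlfR` from injective, divisibility-reflecting pull-backs of `Φ₀` -/

namespace RealifiedDivisorMonoids

variable {D₀ : Type u₀} [Category.{v₀} D₀] (dm : DivisorMonoids.{u₀, v₀, w} D₀)
  (hpf : ∀ Y : D₀ᵒᵖ, IsPerfFactorial (dm.Φ₀.obj Y))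

/-- **`Φ₀(g)^rlf` is injective** for `g : Y ⟶ Y'` as soon as `Φ₀(g)` is injective and REFLECTS divisibility
([FrdI] row P53/L02a `IsPerfFactorial.Rlf.map_injective_of_reflects` at the [EtTh] Def. 3.3 (iii) data) — the
hypothesis `hrlf` of the sibling's `ofRlfR_hBinj_of_rlfMap_injective`, DISCHARGED on this route.
[cite: MochizukiEtTh2009, Def 3.6 p.76] -/
theorem ofRlfR_rlfMap_injective_of_reflects
    (hΦinj : ∀ {Y Y' : D₀ᵒᵖ} (g : Y ⟶ Y'), Injective (dm.Φ₀.map g).hom)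
    (hΦrefl : ∀ {Y Y' : D₀ᵒᵖ} (g : Y ⟶ Y') (a b : dm.Φ₀.obj Y),
      (dm.Φ₀.map g).hom a ∣ (dm.Φ₀.map g).hom b → a ∣ b)
    {Y Y' : D₀ᵒᵖ} (g : Y ⟶ Y') : Injective (IsPerfFactorial.Rlf.map (hpf Y) (hpf Y') (dm.Φ₀.map g).hom) :=
  IsPerfFactorial.Rlf.map_injective_of_reflects (hpf Y) (hpf Y') _ (hΦinj g) (hΦrefl g)

/-- **`Φ₀^ℝ(g)` (the pull-back of the Def. 3.6 (i) datum `Φ₀^ℝ := Φ₀^rlf` of `ofRlfR`) is injective** from `hΦinj`,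
`hΦrefl` (`Φ₀^ℝ(g)` is `Φ₀(g)^rlf`, `rlfMap_eq_map`). [cite: MochizukiEtTh2009, Def 3.6 p.76] -/
theorem ofRlfR_ΦR_map_injective_of_reflects
    (hΦinj : ∀ {Y Y' : D₀ᵒᵖ} (g : Y ⟶ Y'), Injective (dm.Φ₀.map g).hom)
    (hΦrefl : ∀ {Y Y' : D₀ᵒᵖ} (g : Y ⟶ Y') (a b : dm.Φ₀.obj Y),
      (dm.Φ₀.map g).hom a ∣ (dm.Φ₀.map g).hom b → a ∣ b)
    {Y Y' : D₀ᵒᵖ} (g : Y ⟶ Y') : Injective ((ofRlfR dm hpf).ΦR.map g).hom := by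
  change Injective (rlfMap dm.Φ₀ hpf g)
  rw [IsPerfFactorial.Rlf.rlfMap_eq_map]
  exact ofRlfR_rlfMap_injective_of_reflects dm hpf hΦinj hΦrefl g

/-- **`hBinj` at `ofRlfR dm hpf`** (`Λ = ℝ`, `B₀^ℝ = ℝ·Φ₀^birat ⊆ (Φ₀^rlf)^gp`) **from `hΦinj`, `hΦrefl` alone**: the
pull-backs of `B₀^ℝ` are injective as soon as the pull-backs of `Φ₀` are injective and reflect divisibility (the
sibling's `ofRlfR_hBinj_of_rlfMap_injective` fed with `ofRlfR_rlfMap_injective_of_reflects`).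
[cite: MochizukiEtTh2009, Def 3.6 p.76] -/
theorem ofRlfR_hBinj_of_reflects
    (hΦinj : ∀ {Y Y' : D₀ᵒᵖ} (g : Y ⟶ Y'), Injective (dm.Φ₀.map g).hom)
    (hΦrefl : ∀ {Y Y' : D₀ᵒᵖ} (g : Y ⟶ Y') (a b : dm.Φ₀.obj Y),
      (dm.Φ₀.map g).hom a ∣ (dm.Φ₀.map g).hom b → a ∣ b) :
    ∀ {Y Y' : D₀ᵒᵖ} (g : Y ⟶ Y'), Injective ((ofRlfR dm hpf).BΛ.map g).hom :=
  ofRlfR_hBinj_of_rlfMap_injective dm hpf fun g => ofRlfR_rlfMap_injective_of_reflects dm hpf hΦinj hΦrefl g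

/-- **Def. 3.6 (i): `Φ₀^ℝ := Φ₀^rlf` IS a monoid on `D₀`** ([FrdI] Def. 1.1 (ii); row P53/L02a
`isMonoidOn_rlfFunctor_of_reflects` at the [EtTh] data) when `Φ₀` is a monoid on `D₀` (Prop. 3.4 (i): "the functor
`Φ₀` defines a divisorial monoid on `D₀`") whose pull-backs reflect divisibility. [cite: MochizukiEtTh2009, Def 3.6 p.76] -/
theorem isMonoidOn_ΦR_ofRlfR_of_reflects (hΦmon : IsMonoidOn dm.Φ₀)
    (hΦrefl : ∀ {Y Y' : D₀ᵒᵖ} (g : Y ⟶ Y') (a b : dm.Φ₀.obj Y),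
      (dm.Φ₀.map g).hom a ∣ (dm.Φ₀.map g).hom b → a ∣ b) :
    IsMonoidOn (ofRlfR dm hpf).ΦR :=
  isMonoidOn_rlfFunctor_of_reflects hpf hΦmon fun _ _ α a b h => hΦrefl α.op a b h

/-- The injectivity clause `hΦinj` is part of "`Φ₀` is a monoid on `D₀`" ([FrdI] Def. 1.1 (ii) (a): pull-backs
characteristically injective), so `hBinj` at `ofRlfR` also follows from Prop. 3.4 (i)'s "`Φ₀` defines a divisorial
monoid on `D₀`" (read in the tree's [FrdI] vocabulary) plus divisibility reflection. [cite: MochizukiEtTh2009, Def 3.6 p.76] -/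
theorem ofRlfR_hBinj_of_isMonoidOn_of_reflects (hΦmon : IsMonoidOn dm.Φ₀)
    (hΦrefl : ∀ {Y Y' : D₀ᵒᵖ} (g : Y ⟶ Y') (a b : dm.Φ₀.obj Y),
      (dm.Φ₀.map g).hom a ∣ (dm.Φ₀.map g).hom b → a ∣ b) :
    ∀ {Y Y' : D₀ᵒᵖ} (g : Y ⟶ Y'), Injective ((ofRlfR dm hpf).BΛ.map g).hom :=
  ofRlfR_hBinj_of_reflects dm hpf (fun g => (hΦmon.isCharInjective g.unop).1) hΦrefl

end RealifiedDivisorMonoids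

/-! ### §2 The structural consumers over `ofRlfR`, on the two `Φ₀`-clauses -/

namespace TemperedFrobenioid

section FSMType

variable {D₀ : Type u₀} [Category.{v₀} D₀] (dm : DivisorMonoids.{u₀, v₀, w} D₀)
  (hpf : ∀ Y : D₀ᵒᵖ, IsPerfFactorial (dm.Φ₀.obj Y)) {D : Type u} [Category.{v} D]
  {IsRational IsStrictlyRational : (Dᵒᵖ ⥤ CommMonCat.{w}) → Prop}
  (C₀ : TemperedFrobenioid (RealifiedDivisorMonoids.ofRlfR dm hpf) D (treeCatVocab D IsRational IsStrictlyRational))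

/-- **`hBmon` for monoid type `ℝ` over a base of FSM-type**: `B = B₀^ℝ|_D ×_{(Φ^{ℝ-log})^gp} Φ^gp` is a monoid on
`D` ([FrdI] Def. 1.1 (ii)) for EVERY tempered Frobenioid over `ofRlfR dm hpf`, from `hΦinj`, `hΦrefl`.
[cite: MochizukiEtTh2009, Def 3.6 p.77] -/
theorem isMonoidOn_ratFnFunctor_ofRlfR_of_isOfFSMType
    (hΦinj : ∀ {Y Y' : D₀ᵒᵖ} (g : Y ⟶ Y'), Injective (dm.Φ₀.map g).hom)
    (hΦrefl : ∀ {Y Y' : D₀ᵒᵖ} (g : Y ⟶ Y') (a b : dm.Φ₀.obj Y),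
      (dm.Φ₀.map g).hom a ∣ (dm.Φ₀.map g).hom b → a ∣ b)
    (hD : IsOfFSMType D) : IsMonoidOn C₀.ratFnFunctor :=
  C₀.isMonoidOn_ratFnFunctor_of_isOfFSMType (RealifiedDivisorMonoids.ofRlfR_hBinj_of_reflects dm hpf hΦinj hΦrefl) hD

/-- **Def. 3.6 (ii), last sentence, at `Λ = ℝ`: "the data `(D, Φ, B, B → Φ^gp)` determines a model Frobenioid `C`"
— a tempered Frobenioid of monoid type `ℝ` over the constructed data `ofRlfR` and a base of FSM-type IS a Frobenioid**,
from `hΦinj`, `hΦrefl`. [cite: MochizukiEtTh2009, Def 3.6 p.77] -/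
theorem isFrobenioid_ofRlfR_of_isOfFSMType
    (hΦinj : ∀ {Y Y' : D₀ᵒᵖ} (g : Y ⟶ Y'), Injective (dm.Φ₀.map g).hom)
    (hΦrefl : ∀ {Y Y' : D₀ᵒᵖ} (g : Y ⟶ Y') (a b : dm.Φ₀.obj Y),
      (dm.Φ₀.map g).hom a ∣ (dm.Φ₀.map g).hom b → a ∣ b)
    (hD : IsOfFSMType D) : PreFrobenioid.IsFrobenioid C₀.toElem :=
  C₀.isFrobenioid_of_isOfFSMType (RealifiedDivisorMonoids.ofRlfR_hBinj_of_reflects dm hpf hΦinj hΦrefl) hD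

/-- Same over any base satisfying Rmk. 3.7.2 (`D` slim and of FSM-type). [cite: MochizukiEtTh2009, Thm 3.7 p.80] -/
theorem isFrobenioid_ofRlfR_of_remark372 (h372 : Remark372 D)
    (hΦinj : ∀ {Y Y' : D₀ᵒᵖ} (g : Y ⟶ Y'), Injective (dm.Φ₀.map g).hom)
    (hΦrefl : ∀ {Y Y' : D₀ᵒᵖ} (g : Y ⟶ Y') (a b : dm.Φ₀.obj Y),
      (dm.Φ₀.map g).hom a ∣ (dm.Φ₀.map g).hom b → a ∣ b) :
    PreFrobenioid.IsFrobenioid C₀.toElem :=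
  C₀.isFrobenioid_ofRlfR_of_isOfFSMType dm hpf hΦinj hΦrefl h372.2.1

end FSMType

section ConnectedTemperoid

variable {G : Type u} [Group G] [TopologicalSpace G] {D₀ : Type u₀} [Category.{v₀} D₀]
  (dm : DivisorMonoids.{u₀, v₀, w} D₀) (hpf : ∀ Y : D₀ᵒᵖ, IsPerfFactorial (dm.Φ₀.obj Y))
  {IsRational IsStrictlyRational : ((ConnectedPart (BTemp G))ᵒᵖ ⥤ CommMonCat.{w}) → Prop}
  (C₀ : TemperedFrobenioid (RealifiedDivisorMonoids.ofRlfR dm hpf) (ConnectedPart (BTemp G))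
    (treeCatVocab (ConnectedPart (BTemp G)) IsRational IsStrictlyRational))

/-- **`hBmon` for monoid type `ℝ` at print's GENUINE base `D = B^temp(Π)⁰`** (any topological group `Π`), from
`hΦinj`, `hΦrefl` (the FSM clause is [FrdII] Ex. 1.3 (i)). [cite: MochizukiEtTh2009, Def 3.6 p.77] -/
theorem isMonoidOn_ratFnFunctor_ofRlfR_connectedPart_bTemp
    (hΦinj : ∀ {Y Y' : D₀ᵒᵖ} (g : Y ⟶ Y'), Injective (dm.Φ₀.map g).hom)
    (hΦrefl : ∀ {Y Y' : D₀ᵒᵖ} (g : Y ⟶ Y') (a b : dm.Φ₀.obj Y),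
      (dm.Φ₀.map g).hom a ∣ (dm.Φ₀.map g).hom b → a ∣ b) :
    IsMonoidOn C₀.ratFnFunctor :=
  C₀.isMonoidOn_ratFnFunctor_connectedPart_bTemp (RealifiedDivisorMonoids.ofRlfR_hBinj_of_reflects dm hpf hΦinj hΦrefl)

/-- **A tempered Frobenioid of monoid type `ℝ` over the constructed data `ofRlfR` and the genuine base `B^temp(Π)⁰`
IS a Frobenioid** — NO Def-3.6-level binder: only the Def. 3.3 (iii)-level clauses `hΦinj`, `hΦrefl`.
[cite: MochizukiEtTh2009, Def 3.6 p.77] -/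
theorem isFrobenioid_ofRlfR_connectedPart_bTemp
    (hΦinj : ∀ {Y Y' : D₀ᵒᵖ} (g : Y ⟶ Y'), Injective (dm.Φ₀.map g).hom)
    (hΦrefl : ∀ {Y Y' : D₀ᵒᵖ} (g : Y ⟶ Y') (a b : dm.Φ₀.obj Y),
      (dm.Φ₀.map g).hom a ∣ (dm.Φ₀.map g).hom b → a ∣ b) :
    PreFrobenioid.IsFrobenioid C₀.toElem :=
  C₀.isFrobenioid_connectedPart_bTemp (RealifiedDivisorMonoids.ofRlfR_hBinj_of_reflects dm hpf hΦinj hΦrefl)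

/-- **Thm. 3.7 (iv), conclusion «`C` is slim», for monoid type `ℝ` at the genuine base** (`Π` tempered and
temp-slim), on the two `Φ₀`-clauses — the `hBinj`-form of `Sec3Thm37ivGenuineBase` §3 re-based; cf. abc-iut-f-047's
hypothesis-free `thm37_iv_ofRlfR_holds` for the named `Prop`. [cite: MochizukiEtTh2009, Thm 3.7 p.80] -/
theorem isSlim_category_ofRlfR_connectedPart_bTemp_of_reflects [IsTopologicalGroup G]
    (hG : IsTempered G) (hZ : IsSlimGroup G)
    (hΦinj : ∀ {Y Y' : D₀ᵒᵖ} (g : Y ⟶ Y'), Injective (dm.Φ₀.map g).hom)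
    (hΦrefl : ∀ {Y Y' : D₀ᵒᵖ} (g : Y ⟶ Y') (a b : dm.Φ₀.obj Y),
      (dm.Φ₀.map g).hom a ∣ (dm.Φ₀.map g).hom b → a ∣ b) :
    IsSlim C₀.category :=
  C₀.isSlim_category_ofRlfR_connectedPart_bTemp dm hpf hG hZ
    (RealifiedDivisorMonoids.ofRlfR_hBinj_of_reflects dm hpf hΦinj hΦrefl)

end ConnectedTemperoid

end TemperedFrobenioid

end Literature.AnabelianGeometry.EtaleTheta
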